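import Literature.Analysis.UnboundedOperators.UnitaryGroupGenerator
import HarnessLib

/-!
# Discharged fact: the Hamiltonian on differentiable orbits (`UnitaryRep`)

`Literature/Analysis/UnboundedOperators/UnitaryRep.lean` (item C4) records the named fact
`Literature.Analysis.UnboundedOperators.UnitaryRep.hamiltonian_apply_of_hasDerivAt`:

> if the orbit `t ↦ U(t) ψ` of a strongly continuous one-parameter unitary group is
> differentiable at `0` with derivative `η`, then `ψ ∈ D(H)` and `H ψ = -i η`
> (Reed–Simon I, Thm. VIII.7 (c)–(d): for `ψ ∈ D(A)`, `d/dt U(t) ψ = U(t) A ψ`, and `H = -i A`).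

This file proves it (`hamiltonian_apply_of_hasDerivAt_holds`) from
`OneParameterGroup.mem_generator_domain_of_hasDerivAt` (a two-sided derivative of the orbit at
`0` is the value of the generator `A`, `Literature/Analysis/UnboundedOperators/UnitaryGroupGenerator.lean`)
and the unfolding lemma `UnitaryRep.hamiltonian_apply` (`H x = -i • A x`).

It also discharges **Stone's theorem** (generator half), the named fact
`Literature.Analysis.UnboundedOperators.UnitaryRep.isSelfAdjoint_hamiltonian`:

> the Hamiltonian `H = -i A` of a strongly continuous one-parameter unitary group is self-adjoint
> (Stone (1932); Reed–Simon I, Thm. VIII.8; Goldstein (1985), Ch. I Thm. 4.7; Pazy (1983),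
> Thm. 1.10.8; Engel–Nagel (2006), Thm. II.3.24: the generator of a unitary group is
> skew-adjoint, `A* = -A`),

as `isSelfAdjoint_hamiltonian_holds`, by the adjoint-semigroup argument of Goldstein (1985),
Ch. I Thms. 4.3 and 4.7 (see the section docstring below): `H` is symmetric and densely
defined, so `H ≤ H†`, and every `y ∈ D(H†)` has a differentiable orbit,
`U(t) y = y - ∫₀ᵗ U(s) w ds` with `w = -i H† y`, so `D(H†) ≤ D(A) = D(H)`.

## References

* M. Reed, B. Simon, *Methods of Modern Mathematical Physics I: Functional Analysis* (Academic
  Press, 1980), §VIII.4, Thm. VIII.7, Thm. VIII.8 (Stone's theorem). [ReedSimonI1980]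
* K.-J. Engel, R. Nagel, *One-Parameter Semigroups for Linear Evolution Equations* (Springer GTM
  194, 2000), Ch. II Def. 1.2 (the generator as the derivative of the orbit at `0`). [EngelNagel2000]
* M. H. Stone, *On one-parameter unitary groups in Hilbert space*, Ann. of Math. (2) 33 (1932),
  643–648. [Stone1932]
* J. A. Goldstein, *Semigroups of Linear Operators and Applications* (Oxford University Press,
  1985), Ch. I §4: Thm. 4.3 (the adjoint semigroup is generated by `A*`), Thm. 4.7 (Stone).
  [Goldstein1985]
* A. Pazy, *Semigroups of Linear Operators and Applications to Partial Differential Equations*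
  (Springer, 1983), §1.10: Cor. 10.6, Thm. 10.8 (Stone). [Pazy1983]
* K.-J. Engel, R. Nagel, *A Short Course on Operator Semigroups* (Springer Universitext, 2006),
  II.2.5 (adjoint semigroups), Thm. II.3.24 (Stone). [EngelNagel2006]
-/

noncomputable section

namespace Literature.Analysis.UnboundedOperators

namespace UnitaryRep

variable {H : Type*} [NormedAddCommGroup H] [InnerProductSpace ℂ H] [CompleteSpace H]

/-- **Discharge of `UnitaryRep.hamiltonian_apply_of_hasDerivAt`**: if `t ↦ U(t) ψ` has derivative
`η` at `t = 0`, then `ψ ∈ D(H)` and `H ψ = -i η`, where `H = -i A` is the Hamiltonian (Stone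
generator) of the strongly continuous one-parameter unitary group `U(t) = exp (t A)`.
Reed–Simon I, Thm. VIII.7 (c)–(d); the derivative of the orbit at `0` is the generator,
Engel–Nagel Ch. II Def. 1.2 (`OneParameterGroup.mem_generator_domain_of_hasDerivAt`).
[cite: ReedSimonI1980, Thm. VIII.7] -/
theorem hamiltonian_apply_of_hasDerivAt_holds : hamiltonian_apply_of_hasDerivAt (H := H) := by
  intro U ψ η h
  obtain ⟨hψ, hA⟩ := OneParameterGroup.mem_generator_domain_of_hasDerivAt
    U.toStrongContRepresentation (y := η) (by simpa only [app_toStrongContRepresentation] using h)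
  exact ⟨hψ, by rw [hamiltonian_apply]; exact congrArg (fun v : H => (-Complex.I) • v) hA⟩

end UnitaryRep

/-! ### Stone's theorem: the Hamiltonian of a one-parameter unitary group is self-adjoint

Discharge of the named fact `UnitaryRep.isSelfAdjoint_hamiltonian` (Stone (1932); Reed–Simon I,
Thm. VIII.8; Goldstein (1985), Ch. I Thm. 4.7; Pazy (1983), Thm. 1.10.8; Engel–Nagel, *A Short
Course on Operator Semigroups* (2006), Thm. II.3.24: the generator `A` of a strongly continuous
unitary group is skew-adjoint, `A* = -A`; equivalently `H = -i A` is self-adjoint).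

Proof: the adjoint-semigroup argument of Goldstein (1985), Ch. I, Thms. 4.3 and 4.7 (also Pazy
Thm. 1.10.8, Engel–Nagel II.2.5 with II.3.24). `D(H) = D(A)` is dense
(`OneParameterGroup.dense_generator_domain`, Engel–Nagel (2000) Thm. II.1.4) and `H` is symmetric
(`UnitaryRep.hamiltonian_isSymmetric`), so `H ≤ H†` (Mathlib's
`LinearPMap.IsFormalAdjoint.le_adjoint`). Conversely let `y ∈ D(H†)`, `z = H† y` and `w = -i z`,
so that `⟪w, v⟫ = ⟪y, A v⟫` for all `v ∈ D(A)` (`y ∈ D(A*)` with `A* y = w`). For every `x` and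
every real `t`, `∫₀^{-t} U(s) x ds ∈ D(A)` with `A ∫₀^{-t} U(s) x ds = U(-t) x - x` (Engel–Nagel
(2000) Lemma II.1.3 (iii), `OneParameterGroup.integral_mem_generator_domain`), whence, using
`U(s)* = U(-s)` (Goldstein, proof of Thm. 4.3: `⟨f, T(t)* g - g⟩ = ∫₀ᵗ ⟨f, T(s)* A* g⟩ ds`),
`⟪x, U(t) y - y⟫ = ⟪U(-t) x - x, y⟫ = ⟪∫₀^{-t} U(s) x ds, w⟫ = ∫₀^{-t} ⟪x, U(-s) w⟫ ds
  = -⟪x, ∫₀^{t} U(s) w ds⟫`,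
i.e. `U(t) y = y - ∫₀ᵗ U(s) w ds`. By the fundamental theorem of calculus the orbit of `y` is
differentiable at `0` with derivative `-w`, so `y ∈ D(A)` (and `A y = -w = i z`, `H y = z`;
Goldstein Thm. 4.7: `A* f = -A f`). Hence `D(H†) ≤ D(H)` and `H† = H`. No spectral theorem and no
resolvent estimates are used. -/

namespace UnitaryRep

open Filter _root_.MeasureTheory intervalIntegral
open scoped InnerProductSpace ComplexConjugate

variable {H : Type*} [NormedAddCommGroup H] [InnerProductSpace ℂ H] [CompleteSpace H]

/-- `⟪x, U(t) y⟫ = ⟪U(-t) x, y⟫`: the adjoint of `U(t)` is `U(-t)` (Reed–Simon I, §VIII.4;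
Goldstein (1985), Ch. I, proof of Thm. 4.7, `U(-t) = U(t)*`). [folklore] -/
theorem inner_appReal_right (U : OneParameterUnitaryGroup H) (t : ℝ) (x y : H) :
    ⟪x, U.appReal t y⟫_ℂ = ⟪U.appReal (-t) x, y⟫_ℂ := by
  rw [inner_appReal_left, neg_neg]

/-- The inner product commutes with the orbit integral:
`⟪x, ∫ₐᵇ U(s) z ds⟫ = ∫ₐᵇ ⟪x, U(s) z⟫ ds` (a continuous linear functional passes under the
Bochner integral, Mathlib's `ContinuousLinearMap.intervalIntegral_comp_comm`). [folklore] -/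
theorem inner_integral_appReal (U : OneParameterUnitaryGroup H) (x z : H) (a b : ℝ) :
    ⟪x, ∫ s in a..b, U.appReal s z⟫_ℂ = ∫ s in a..b, ⟪x, U.appReal s z⟫_ℂ := by
  have hi : IntervalIntegrable (fun s => U.appReal s z) volume a b :=
    (U.continuous_appReal_apply z).intervalIntegrable a b
  calc ⟪x, ∫ s in a..b, U.appReal s z⟫_ℂ = innerSL ℂ x (∫ s in a..b, U.appReal s z) := rfl
    _ = ∫ s in a..b, innerSL ℂ x (U.appReal s z) :=
        ((innerSL ℂ x).intervalIntegral_comp_comm hi).symm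
    _ = ∫ s in a..b, ⟪x, U.appReal s z⟫_ℂ := rfl

/-- **Key identity of the adjoint-semigroup argument.** If `w` is a weak adjoint vector of `y`
for the generator `A` of `U(t) = exp (t A)`, i.e. `⟪w, v⟫ = ⟪y, A v⟫` for all `v ∈ D(A)`
(`y ∈ D(A*)`, `A* y = w`), then `U(t) y - y = -∫₀ᵗ U(s) w ds` for every real `t`. This is
Goldstein (1985), Ch. I, proof of Thm. 4.3, `T(t)* g - g = ∫₀ᵗ T(s)* A* g ds` for `g ∈ D(A*)`,
for the unitary group with `T(t)* = U(-t)` (and `t ↦ -t`); the proof pairs with an arbitrary `x`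
and uses `A ∫₀^{-t} U(s) x ds = U(-t) x - x` (Engel–Nagel (2000), Lemma II.1.3 (iii)).
[cite: Goldstein1985, Ch. I Thm. 4.3 (proof)] -/
theorem appReal_apply_sub_eq_of_inner_generator (U : OneParameterUnitaryGroup H) {y w : H}
    (h : ∀ v : (OneParameterGroup.generator U.toStrongContRepresentation).domain,
      ⟪w, (v : H)⟫_ℂ = ⟪y, OneParameterGroup.generator U.toStrongContRepresentation v⟫_ℂ)
    (t : ℝ) :
    U.appReal t y - y = -∫ s in (0 : ℝ)..t, U.appReal s w := by
  refine ext_inner_left ℂ fun x => ?_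
  obtain ⟨hm, hAm⟩ :=
    OneParameterGroup.integral_mem_generator_domain U.toStrongContRepresentation x (-t)
  -- `hw : ⟪w, ∫₀^{-t} U(s) x ds⟫ = ⟪y, U(-t) x - x⟫`
  have hw : ⟪w, ∫ s in (0 : ℝ)..(-t), U.appReal s x⟫_ℂ = ⟪y, U.appReal (-t) x - x⟫_ℂ := by
    have := h ⟨_, hm⟩
    rw [hAm] at this
    exact this
  have h1 : ⟪x, U.appReal t y - y⟫_ℂ = ⟪U.appReal (-t) x - x, y⟫_ℂ := by
    rw [inner_sub_right, inner_sub_left, inner_appReal_right]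
  have h2 : ⟪U.appReal (-t) x - x, y⟫_ℂ = ⟪∫ s in (0 : ℝ)..(-t), U.appReal s x, w⟫_ℂ := by
    rw [← inner_conj_symm, ← hw, inner_conj_symm]
  have h3 : ⟪∫ s in (0 : ℝ)..(-t), U.appReal s x, w⟫_ℂ =
      -∫ u in (0 : ℝ)..t, ⟪x, U.appReal u w⟫_ℂ := by
    rw [← inner_conj_symm, inner_integral_appReal]
    have hpt : (fun s => ⟪w, U.appReal s x⟫_ℂ) =
        fun s => conj ((fun u => ⟪x, U.appReal u w⟫_ℂ) (-s)) := by
      funext s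
      rw [inner_appReal_right, ← inner_conj_symm]
    rw [hpt, intervalIntegral_conj, starRingEnd_self_apply,
      intervalIntegral.integral_comp_neg (fun u => ⟪x, U.appReal u w⟫_ℂ), neg_neg, neg_zero,
      intervalIntegral.integral_symm]
  calc ⟪x, U.appReal t y - y⟫_ℂ = ⟪U.appReal (-t) x - x, y⟫_ℂ := h1
    _ = ⟪∫ s in (0 : ℝ)..(-t), U.appReal s x, w⟫_ℂ := h2
    _ = -∫ u in (0 : ℝ)..t, ⟪x, U.appReal u w⟫_ℂ := h3
    _ = ⟪x, -∫ s in (0 : ℝ)..t, U.appReal s w⟫_ℂ := by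
        rw [inner_neg_right, inner_integral_appReal]

/-- **The adjoint of the generator of a unitary group is `-A` on `D(A*)`.** If
`⟪w, v⟫ = ⟪y, A v⟫` for all `v ∈ D(A)`, then `y ∈ D(A)` and `A y = -w`: by
`appReal_apply_sub_eq_of_inner_generator` and the fundamental theorem of calculus the orbit
`t ↦ U(t) y = y - ∫₀ᵗ U(s) w ds` has derivative `-w` at `t = 0` (Goldstein (1985), Ch. I
Thm. 4.7, necessity: `f ∈ D(A*)` implies `f ∈ D(A)` and `A* f = -A f`, via Thm. 4.3, "divide by
`t` and let `t → 0`"; Pazy (1983), Thm. 1.10.8). [cite: Goldstein1985, Ch. I Thm. 4.7] -/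
theorem mem_generator_domain_of_inner_generator (U : OneParameterUnitaryGroup H) {y w : H}
    (h : ∀ v : (OneParameterGroup.generator U.toStrongContRepresentation).domain,
      ⟪w, (v : H)⟫_ℂ = ⟪y, OneParameterGroup.generator U.toStrongContRepresentation v⟫_ℂ) :
    ∃ hy : y ∈ (OneParameterGroup.generator U.toStrongContRepresentation).domain,
      OneParameterGroup.generator U.toStrongContRepresentation ⟨y, hy⟩ = -w := by
  apply OneParameterGroup.mem_generator_domain_of_hasDerivAt
  have h0 :=
    (((U.continuous_appReal_apply w).integral_hasStrictDerivAt 0 0).hasDerivAt).const_sub y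
  rw [appReal_zero, one_apply_eq_self] at h0
  refine h0.congr_of_eventuallyEq (Eventually.of_forall fun t => ?_)
  show U.appReal t y = y - ∫ s in (0 : ℝ)..t, U.appReal s w
  rw [sub_eq_add_neg, ← U.appReal_apply_sub_eq_of_inner_generator h t]
  abel

/-- The domain of the Hamiltonian of a one-parameter unitary group is dense (it is the domain of
the generator `A`; Engel–Nagel (2000), Ch. II Thm. 1.4,
`OneParameterGroup.dense_generator_domain`; Reed–Simon I, proof of Thm. VIII.8).
[cite: EngelNagel2000, Ch. II Thm. 1.4] -/
theorem dense_hamiltonian_domain (U : OneParameterUnitaryGroup H) :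
    Dense (U.hamiltonian.domain : Set H) :=
  OneParameterGroup.dense_generator_domain U.toStrongContRepresentation

/-- `H ≤ H†`: a densely defined symmetric operator is contained in its adjoint (Reed–Simon I,
§VIII.2, Definition p. 255; Goldstein (1985), Ch. I Def. 4.4; Mathlib's
`LinearPMap.IsFormalAdjoint.le_adjoint`). [folklore] -/
theorem hamiltonian_le_adjoint (U : OneParameterUnitaryGroup H) :
    U.hamiltonian ≤ U.hamiltonian.adjoint :=
  LinearPMap.IsFormalAdjoint.le_adjoint U.dense_hamiltonian_domain U.hamiltonian_isSymmetric

/-- `D(H†) ≤ D(H)`: every vector in the domain of the adjoint of the Hamiltonian lies in the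
domain of the generator. For `y ∈ D(H†)` with `z = H† y`, the vector `w = -i z` satisfies
`⟪w, v⟫ = ⟪y, A v⟫` on `D(A)`, so `y ∈ D(A) = D(H)` by `mem_generator_domain_of_inner_generator`
(Goldstein (1985), Ch. I Thm. 4.7, `D(A*) = D(A)`; Pazy (1983), Thm. 1.10.8; Engel–Nagel (2006),
Thm. II.3.24). [cite: Goldstein1985, Ch. I Thm. 4.7] -/
theorem adjoint_hamiltonian_domain_le (U : OneParameterUnitaryGroup H) :
    U.hamiltonian.adjoint.domain ≤ U.hamiltonian.domain := by
  intro y hy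
  have hadj : U.hamiltonian.adjoint.IsFormalAdjoint U.hamiltonian :=
    LinearPMap.adjoint_isFormalAdjoint U.dense_hamiltonian_domain
  have h : ∀ v : (OneParameterGroup.generator U.toStrongContRepresentation).domain,
      ⟪(-Complex.I) • (U.hamiltonian.adjoint ⟨y, hy⟩ : H), (v : H)⟫_ℂ =
        ⟪y, OneParameterGroup.generator U.toStrongContRepresentation v⟫_ℂ := by
    intro v
    have hv := hadj ⟨y, hy⟩ v
    rw [hamiltonian_apply, inner_smul_right] at hv
    have hc : (starRingEnd ℂ) (-Complex.I) = Complex.I := by simp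
    rw [inner_smul_left, hv, hc, ← mul_assoc, mul_neg, Complex.I_mul_I, neg_neg, one_mul]
  obtain ⟨hyA, -⟩ := U.mem_generator_domain_of_inner_generator h
  exact hyA

/-- **Discharge of `UnitaryRep.isSelfAdjoint_hamiltonian` (Stone's theorem, generator half).**
The Hamiltonian `H = -i A` of a strongly continuous one-parameter unitary group
`U(t) = exp (t A) = exp (i t H)` on a Hilbert space is self-adjoint, `H† = H`: `H ≤ H†`
(`hamiltonian_le_adjoint`) and `D(H†) ≤ D(H)` (`adjoint_hamiltonian_domain_le`). Stone (1932),
Ann. of Math. 33, 643–648; Reed–Simon I, Thm. VIII.8 (Stone's theorem), with Thm. VIII.7 (c)–(d)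
identifying the domain of the infinitesimal generator as the vectors with differentiable orbit;
in the skew-adjoint form `A* = -A`: Goldstein (1985), Ch. I Thm. 4.7; Pazy (1983), Thm. 1.10.8;
Engel–Nagel (2006), Thm. II.3.24.
[cite: Stone1932, Ann. of Math. 33 (1932) 643–648] [cite: ReedSimonI1980, Thm VIII.8] -/
theorem isSelfAdjoint_hamiltonian_holds : isSelfAdjoint_hamiltonian (H := H) := by
  intro U
  rw [LinearPMap.isSelfAdjoint_def]
  exact (LinearPMap.eq_of_le_of_domain_eq U.hamiltonian_le_adjoint
    (le_antisymm U.hamiltonian_le_adjoint.1 U.adjoint_hamiltonian_domain_le)).symm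

end UnitaryRep

end Literature.Analysis.UnboundedOperators
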